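import Summits.QuantumFields.YangMills.Theorems.PoincareLipschitzLinAvgCurlEll2
import HarnessLib

/-!
# Line «poincare_lipschitz» on crux `HistoryTailL` (stmt-QuantumFields-19936), route crux `BlockLipschitzL` (stmt-QuantumFields-23533):
# the GAUSSIAN-MODEL SHADOW of the displayed row «average stability modulo gauge» — the bond value of the k-fold (0.4) LINEAR average,
# MODULO ITS COBOUNDARY, has the full `ℓ²`-gain `√((L^k)²/(L^k)^d)` (= `L^{−k/2}` in d = 3) at EVERY depth

Cell `ym3-torus` (YM ladder rung R3 = continuum SU(2) Yang–Mills on the three-torus — a RUNG, NOT the Clay problem: not d = 4, not infinite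
volume, not a mass gap), LEAD seat `ym-ust-19936-w1` gen 7.  LINEAR MODEL ONLY; route-independent imports (✓`PoincareLipschitzLinAvgCurlEll2`).

CONTEXT.  The K2-TOP door ✓`PoincareLipschitzIteratedOfAvgStability.stub_iteratedLipschitz_of_avgStabilityModGauge` (p679967) and its by-name
layer ✓`PoincareLipschitzBlockLipschitzOfAvgStability.blockLipschitzL_of_avgStabilityModGauge` (p680477) reduce `BlockLipschitzL` to ONE displayed
row: for hierarchically small pairs `U, U'` there is a level-`j` GAUGE TRANSFORMATION `h` with `dist1(Ū^j(U)_b·((Ū^j U')^h_b)⁻¹) ≤ CS/√(L^{j+1})·‖U − U'‖_{ℓ²(box)}`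
on the footprint of `∂a` — and the gauge infimum is load-bearing (the un-quotiented row is false by a one-site gauge witness).  The sibling letter
✓`PoincareLipschitzLinAvgEll2.abs_curlAt_linAvgIter_le_sqrt` records the linear model of the CURL (where the coboundary drops out) and notes that the
RAW bond value of the linear average has NO `ℓ²`-gain (the contour coboundary carries O(1) weight on the first letters out of a block centre).

THIS FILE (§1: the linear shadow of the row itself; §2 (v1.1): the `ℓ¹ → sup` shadow of remainder propagation): the linear shadow of the row itself — modulo the coboundary `cobd Φ` of the tree's closed form
✓`AbelianEML.linAvgIter_eq_tubeSum_sub_cobd` (`linAvgIter k a = (L^k)^{−d}·tubeSum k a − cobd Φ`), the bond value IS `ℓ²`-small at every depth: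
`|linAvgIter k a c + cobd Φ c| = (L^k)^{−d}·|tubeSum k a c| ≤ √((L^k)²/(L^k)^d)·(Σ_b a_b²)^{1/2}` (✓`abs_tubeSum_le_sqrt`: Cauchy–Schwarz with the exact
multiplicity `L^k` of a fine bond among the `(L^k)^d` translated tubes of length `L^k`).  In d = 3 this is `L^{−k/2}·‖a‖_{ℓ²} = √L·L^{−(k+1)/2}·‖a‖_{ℓ²}`:
the displayed row's rate with `CS := √L`, the coboundary `cobd Φ` playing the part of the linearised gauge transformation `h = exp(Φ)`.  So the row
is SHARP IN SHAPE in the Gaussian model (gain attained on constant one-forms) and its `∃ h` is exactly the linear model's `− cobd Φ`.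

WHAT THIS IS NOT: the non-abelian row (Bałaban's averaging regularity modulo gauge, [Balaban1985Averaging] Props 1–3) is NOT proved; nothing here
proves `BlockLipschitzL`, `HistoryTailL`, rung R3 or a summit statement. [folklore]
-/

set_option autoImplicit false

noncomputable section

namespace Summit.QuantumFields.YangMills.Theorems.PoincareLipschitzLinAvgModCobdEll2

open scoped BigOperators
open Literature.MathematicalPhysics.QuantumFieldTheory.Balaban1983to89
open Literature.MathematicalPhysics.QuantumFieldTheory.Balaban1983to89.B10Eq38TorusDomains (toFine)
open Summit.QuantumFields.YangMills.Theorems.AbelianEML (linAvgIter tubeSum cobd bsite linAvgIter_eq_tubeSum_sub_cobd linAvgIter_gaugeFix)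
open Literature.MathematicalPhysics.QuantumFieldTheory.Balaban1983to89.BlockAveragingEMLProp2 (shiftN_apply)
open Literature.MathematicalPhysics.QuantumFieldTheory.Balaban1983to89.B10Eq47AxialChi (shiftN)
open Summit.QuantumFields.YangMills.Theorems.PoincareLipschitzLinAvgEll2
  (abs_tubeSum_le_sqrt bsite_injective bond_mk_injective sum_sum_range_comp_le_of_injective)

variable {P : Params}

/-- **THE TUBE AVERAGE IS `ℓ²`-SMALL**: `(L^k)^{−d}·|tubeSum k a c| ≤ √((L^k)²/(L^k)^d)·(Σ_b a_b²)^{1/2}` (✓`abs_tubeSum_le_sqrt` and the constant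
bookkeeping `(L^k)^{−d}·√((L^k)^d·L^k)·√(L^k) = √((L^k)²/(L^k)^d)`). [folklore] -/
theorem abs_tubeAvg_le_sqrt {k : ℕ} (hk : k ≤ P.m + P.K) (a : PBond P 0 → ℝ) (c : PBond P k) :
    |(((P.L : ℝ) ^ k) ^ P.d)⁻¹ * tubeSum k a c| ≤
      Real.sqrt (((P.L : ℝ) ^ k) ^ 2 / ((P.L : ℝ) ^ k) ^ P.d) * Real.sqrt (∑ b : PBond P 0, a b ^ 2) := by
  obtain ⟨X, κ⟩ := c
  set Ld : ℝ := ((P.L : ℝ) ^ k) ^ P.d with hLd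
  set M : ℝ := ((P.L ^ k : ℕ) : ℝ) with hM
  set S : ℝ := ∑ b : PBond P 0, a b ^ 2 with hS
  have hL0 : (0 : ℝ) < P.L := by exact_mod_cast P.L_pos
  have hM0 : 0 < M := by rw [hM]; exact_mod_cast pow_pos P.L_pos k
  have hMe : M = (P.L : ℝ) ^ k := by rw [hM]; push_cast; ring
  have hLd0 : 0 < Ld := by rw [hLd]; positivity
  rw [abs_mul, abs_inv, abs_of_pos hLd0]
  have h1 := abs_tubeSum_le_sqrt hk a X κ
  have hLdM : Real.sqrt (((P.L : ℝ) ^ k) ^ P.d * (P.L ^ k : ℕ)) * Real.sqrt (((P.L ^ k : ℕ) : ℝ) * ∑ b : PBond P 0, a b ^ 2)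
      = Real.sqrt (Ld * M) * Real.sqrt (M * S) := by rw [hLd, hM, hS]
  rw [hLdM] at h1
  -- constants: `Ld⁻¹ · √(Ld M) · √(M S) = √(M²/Ld) · √S`
  have hkey : Ld⁻¹ * (Real.sqrt (Ld * M) * Real.sqrt (M * S)) = Real.sqrt (M ^ 2 / Ld) * Real.sqrt S := by
    have e1 : Real.sqrt (Ld * M) * Real.sqrt (M * S) = Real.sqrt Ld * M * Real.sqrt S := by
      rw [Real.sqrt_mul hLd0.le, Real.sqrt_mul hM0.le]
      have : Real.sqrt M * Real.sqrt M = M := Real.mul_self_sqrt hM0.le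
      calc Real.sqrt Ld * Real.sqrt M * (Real.sqrt M * Real.sqrt S)
          = Real.sqrt Ld * (Real.sqrt M * Real.sqrt M) * Real.sqrt S := by ring
        _ = Real.sqrt Ld * M * Real.sqrt S := by rw [this]
    have e2 : Real.sqrt (M ^ 2 / Ld) = M / Real.sqrt Ld := by
      rw [Real.sqrt_div (sq_nonneg _), Real.sqrt_sq hM0.le]
    have hsL : 0 < Real.sqrt Ld := Real.sqrt_pos.mpr hLd0
    rw [e1, e2, div_eq_mul_inv]
    field_simp
    rw [Real.sq_sqrt hLd0.le]
  calc Ld⁻¹ * |tubeSum k a ⟨X, κ⟩| ≤ Ld⁻¹ * (Real.sqrt (Ld * M) * Real.sqrt (M * S)) :=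
        mul_le_mul_of_nonneg_left h1 (by positivity)
    _ = Real.sqrt (M ^ 2 / Ld) * Real.sqrt S := hkey
    _ = Real.sqrt (((P.L : ℝ) ^ k) ^ 2 / Ld) * Real.sqrt S := by rw [hMe]

/-- **★ THE BOND VALUE OF THE ITERATED (0.4) LINEAR AVERAGE MODULO ITS COBOUNDARY HAS THE FULL `ℓ²`-GAIN AT EVERY DEPTH.**  For every finest
one-form `a` and every level `k ≤ m + K` there is a level-`k` site function `Φ` (the one of the tree's closed form) with, for EVERY level-`k` bond `c`,
`|linAvgIter k a c + cobd Φ c| ≤ √((L^k)²/(L^k)^d)·(Σ_b a_b²)^{1/2}` — in d = 3: `L^{−k/2}·‖a‖_{ℓ²}`, uniformly in `k`. [folklore] -/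
theorem exists_cobd_abs_linAvgIter_add_le_sqrt {k : ℕ} (hk : k ≤ P.m + P.K) (a : PBond P 0 → ℝ) :
    ∃ Φ : Site P k → ℝ, ∀ c : PBond P k,
      |linAvgIter k a c + cobd Φ c| ≤
        Real.sqrt (((P.L : ℝ) ^ k) ^ 2 / ((P.L : ℝ) ^ k) ^ P.d) * Real.sqrt (∑ b : PBond P 0, a b ^ 2) := by
  obtain ⟨Φ, hΦ⟩ := linAvgIter_eq_tubeSum_sub_cobd hk a
  refine ⟨Φ, fun c => ?_⟩
  rw [hΦ, sub_add_cancel]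
  exact abs_tubeAvg_le_sqrt hk a c

/-- **COROLLARY — THE ROW'S SHAPE IN THE LINEAR MODEL: AFTER A GAUGE SHIFT OF THE FINE ONE-FORM, THE AVERAGED BOND VALUES ARE `ℓ²`-SMALL IN SUP.**
With the closed form's `Φ` and ANY finest site function `ψ` reading `Φ` at the block centres (`ψ (toFine k y) = Φ y`; e.g. `Φ ∘ coarsen k` in the
standing range), the gauge-shifted one-form `a + cobd ψ` (same curls as `a`) has `|linAvgIter k (a + cobd ψ) c| ≤ √((L^k)²/(L^k)^d)·‖a‖_{ℓ²}` on EVERY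
level-`k` bond `c` (✓`AbelianEML.linAvgIter_gaugeFix`).  This is the displayed row «∃ h, sup_b dist1(Ū^k(U)_b·((Ū^k U')^h_b)⁻¹) ≤ CS/√(L^{k+1})·‖U − U'‖»
read in the Gaussian model with `U := 1`, `U' := exp(a)`, `h := exp(ψ)`, `CS := √L` (d = 3). [folklore] -/
theorem exists_gaugeShift_forall_abs_linAvgIter_le_sqrt {k : ℕ} (hk : k ≤ P.m + P.K) (a : PBond P 0 → ℝ) :
    ∃ Φ : Site P k → ℝ, ∀ ψ : Site P 0 → ℝ, (∀ y : Site P k, ψ (toFine k y) = Φ y) → ∀ c : PBond P k,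
      |linAvgIter k (a + cobd ψ) c| ≤
        Real.sqrt (((P.L : ℝ) ^ k) ^ 2 / ((P.L : ℝ) ^ k) ^ P.d) * Real.sqrt (∑ b : PBond P 0, a b ^ 2) := by
  obtain ⟨Φ, hΦ⟩ := linAvgIter_eq_tubeSum_sub_cobd hk a
  refine ⟨Φ, fun ψ hψ c => ?_⟩
  rw [linAvgIter_gaugeFix a Φ hΦ ψ hψ c]
  exact abs_tubeAvg_le_sqrt hk a c

/-! ## §2 (v1.1) The `ℓ¹ → sup` shadow: how a REMAINDER field propagates through the tube average

The second half of the K2-at-depth bookkeeping (card v1.26 (R4)): a non-negative/absolute remainder born at a finer level propagates to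
level `k` through the same tube average with the gain `(L^k)·(L^k)^{−d}` (= `L^{−2k}` in d = 3) against its `ℓ¹` MASS — each finest bond lies
on at most `L^k` letters of the tube of a fixed coarse bond (✓`PoincareLipschitzLinAvgEll2.sum_sum_range_comp_le_of_injective` with `g := |r|`). -/

/-- **THE TUBE AVERAGE IS `ℓ¹`-CONTRACTING**: `(L^k)^{−d}·|tubeSum k r c| ≤ (L^k/(L^k)^d)·Σ_b |r_b|` for every finest one-form `r` and every level-`k`
bond `c` (`k ≤ m + K`). [folklore] -/
theorem abs_tubeAvg_le_sum_abs {k : ℕ} (hk : k ≤ P.m + P.K) (r : PBond P 0 → ℝ) (c : PBond P k) :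
    |(((P.L : ℝ) ^ k) ^ P.d)⁻¹ * tubeSum k r c| ≤
      ((P.L : ℝ) ^ k / ((P.L : ℝ) ^ k) ^ P.d) * ∑ b : PBond P 0, |r b| := by
  obtain ⟨X, κ⟩ := c
  have hLd0 : 0 < ((P.L : ℝ) ^ k) ^ P.d := by
    have hL0 : (0 : ℝ) < P.L := by exact_mod_cast P.L_pos
    positivity
  -- injectivity of the tube letters in the offset at fixed position
  have hinj : ∀ s : ℕ, Function.Injective fun q : Fin P.d → Fin (P.L ^ k) => (⟨shiftN (bsite k X q) κ s, κ⟩ : PBond P 0) := by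
    intro s
    have shiftN_injective : Function.Injective fun x : Site P 0 => shiftN x κ s := by
      intro x x' h
      funext ι
      have h1 := congrArg (fun z : Site P 0 => z ι) h
      simp only [shiftN_apply] at h1
      exact add_right_cancel h1
    exact (bond_mk_injective κ).comp (shiftN_injective.comp (bsite_injective hk X))
  have hmult := sum_sum_range_comp_le_of_injective (fun b => |r b|) (fun b => abs_nonneg _)
    (fun (q : Fin P.d → Fin (P.L ^ k)) (s : ℕ) => (⟨shiftN (bsite k X q) κ s, κ⟩ : PBond P 0)) hinj (P.L ^ k)
  -- `|tubeSum| ≤ Σ_q Σ_{s < L^k} |r| ≤ L^k · Σ_b |r_b|`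
  have h1 : |tubeSum k r ⟨X, κ⟩| ≤ ((P.L ^ k : ℕ) : ℝ) * ∑ b : PBond P 0, |r b| := by
    refine le_trans ?_ hmult
    unfold tubeSum
    refine (Finset.abs_sum_le_sum_abs _ _).trans (Finset.sum_le_sum fun q _ => ?_)
    rw [← Fin.sum_univ_eq_sum_range (fun s => |r ⟨shiftN (bsite k X q) κ s, κ⟩|) (P.L ^ k)]
    exact Finset.abs_sum_le_sum_abs _ _
  rw [abs_mul, abs_inv, abs_of_pos hLd0]
  calc (((P.L : ℝ) ^ k) ^ P.d)⁻¹ * |tubeSum k r ⟨X, κ⟩|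
      ≤ (((P.L : ℝ) ^ k) ^ P.d)⁻¹ * (((P.L ^ k : ℕ) : ℝ) * ∑ b : PBond P 0, |r b|) :=
        mul_le_mul_of_nonneg_left h1 (by positivity)
    _ = ((P.L : ℝ) ^ k / ((P.L : ℝ) ^ k) ^ P.d) * ∑ b : PBond P 0, |r b| := by push_cast; ring

/-- **COROLLARY — the coboundary-corrected bond value of the k-fold LINEAR average is `ℓ¹`-contracting too**: with the closed form's `Φ`,
`|linAvgIter k r c + cobd Φ c| ≤ (L^k/(L^k)^d)·‖r‖_{ℓ¹}` (d = 3: `L^{−2k}·‖r‖_{ℓ¹}`) — the linear shadow of how a quadratic remainder born at a finer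
level reaches the footprint at depth. [folklore] -/
theorem exists_cobd_abs_linAvgIter_add_le_sum_abs {k : ℕ} (hk : k ≤ P.m + P.K) (r : PBond P 0 → ℝ) :
    ∃ Φ : Site P k → ℝ, ∀ c : PBond P k,
      |linAvgIter k r c + cobd Φ c| ≤ ((P.L : ℝ) ^ k / ((P.L : ℝ) ^ k) ^ P.d) * ∑ b : PBond P 0, |r b| := by
  obtain ⟨Φ, hΦ⟩ := linAvgIter_eq_tubeSum_sub_cobd hk r
  refine ⟨Φ, fun c => ?_⟩
  rw [hΦ, sub_add_cancel]
  exact abs_tubeAvg_le_sum_abs hk r c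

end Summit.QuantumFields.YangMills.Theorems.PoincareLipschitzLinAvgModCobdEll2

end
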